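import Literature.Analysis.Fourier.HolomorphicParamIntegral
import Mathlib.Analysis.Complex.CauchyIntegral
import HarnessLib

/-!
# Holomorphic dependence of a segment integral with a moving removable singularity

A contour-deformation lemma underlying Cohn–Kumar–Miller–Radchenko–Viazovska, arXiv:1902.05438,
§5.1 ("poles are not an obstacle when `τ ∈ 𝒟`; they will become relevant when we analytically continue
... we can avoid these poles ... by moving the contour appropriately"): suppose `g(w,z)` is, for every
parameter `w` near `w₀`, holomorphic in `z` on a closed rectangle `R = [0,ε] × [t₀−ε,t₀+ε]` except at one
point `σ(w)` near the centre `it₀` where it has a (removable) limit, and holomorphic in `w` with a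
uniform bound for `z` on the three sides of `R` away from the imaginary axis. Then the integral of
`g(w,·)` along the axis side, `w ↦ ∫_{t₀−ε}^{t₀+ε} g(w,iy) dy`, is holomorphic in `w`: by the
Cauchy–Goursat theorem for rectangles (with one exceptional point) it equals the integral over the
other three sides, to which dominated holomorphic differentiation applies.

PROVED here: `differentiableOn_axisSide_integral`.

## References

* H. Cohn, A. Kumar, S. D. Miller, D. Radchenko, M. Viazovska, Ann. of Math. 196 (2022),
  arXiv:1902.05438, §5.1. [CohnEtAl2019]
-/

noncomputable section

open Filter Topology MeasureTheory Metric Set Complex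

namespace Literature.Analysis.Fourier

/-- The closed rectangle `[0,ε] × [t₀−ε, t₀+ε]`. [folklore] -/
def axisRect (t₀ ε : ℝ) : Set ℂ := (Set.uIcc 0 ε) ×ℂ (Set.uIcc (t₀ - ε) (t₀ + ε))

/-- The three sides of `axisRect t₀ ε` away from the imaginary axis, as parametrised point sets. [folklore] -/
def farSides (t₀ ε : ℝ) : Set ℂ :=
  ((fun x : ℝ => (x : ℂ) + (t₀ - ε : ℝ) * I) '' Set.uIcc 0 ε) ∪ ((fun x : ℝ => (x : ℂ) + (t₀ + ε : ℝ) * I) '' Set.uIcc 0 ε) ∪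
    ((fun y : ℝ => (ε : ℂ) + (y : ℂ) * I) '' Set.uIcc (t₀ - ε) (t₀ + ε))

/-- **Segment integrals with a moving removable singularity are holomorphic in the parameter.**
[cite: CohnEtAl2019, §5.1] -/
theorem differentiableOn_axisSide_integral {g : ℂ → ℂ → ℂ} {σ : ℂ → ℂ} {w₀ : ℂ} {t₀ ε δ : ℝ}
    (hε : 0 < ε)
    (hA : ∀ w ∈ ball w₀ δ, ∀ z ∈ axisRect t₀ ε, z ≠ σ w → DifferentiableAt ℂ (g w) z)
    (hB : ∀ w ∈ ball w₀ δ, ∃ L : ℂ, Tendsto (g w) (𝓝[≠] (σ w)) (𝓝 L))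
    (hC : ∀ w ∈ ball w₀ δ, ‖σ w - (t₀ : ℂ) * I‖ < ε / 2)
    (hD : ∀ z ∈ farSides t₀ ε, DifferentiableOn ℂ (fun w => g w z) (ball w₀ δ))
    (hE : ∃ C : ℝ, ∀ w ∈ ball w₀ δ, ∀ z ∈ farSides t₀ ε, ‖g w z‖ ≤ C) :
    DifferentiableOn ℂ (fun w => ∫ y in (t₀ - ε)..(t₀ + ε), g w ((y : ℂ) * I)) (ball w₀ δ) := by
  obtain ⟨C, hCb⟩ := hE
  -- side parametrisations
  set pB : ℝ → ℂ := fun x => (x : ℂ) + (t₀ - ε : ℝ) * I with hpB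
  set pT : ℝ → ℂ := fun x => (x : ℂ) + (t₀ + ε : ℝ) * I with hpT
  set pR : ℝ → ℂ := fun y => (ε : ℂ) + (y : ℂ) * I with hpR
  have memB : ∀ x ∈ Set.uIcc (0 : ℝ) ε, pB x ∈ farSides t₀ ε := fun x hx => Or.inl (Or.inl ⟨x, hx, rfl⟩)
  have memT : ∀ x ∈ Set.uIcc (0 : ℝ) ε, pT x ∈ farSides t₀ ε := fun x hx => Or.inl (Or.inr ⟨x, hx, rfl⟩)
  have memR : ∀ y ∈ Set.uIcc (t₀ - ε) (t₀ + ε), pR y ∈ farSides t₀ ε := fun y hy => Or.inr ⟨y, hy, rfl⟩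
  -- coordinates of the side points
  have pB_re : ∀ x : ℝ, (pB x).re = x := fun x => by simp [hpB]
  have pB_im : ∀ x : ℝ, (pB x).im = t₀ - ε := fun x => by simp [hpB]
  have pT_re : ∀ x : ℝ, (pT x).re = x := fun x => by simp [hpT]
  have pT_im : ∀ x : ℝ, (pT x).im = t₀ + ε := fun x => by simp [hpT]
  have pR_re : ∀ y : ℝ, (pR y).re = ε := fun y => by simp [hpR]
  have pR_im : ∀ y : ℝ, (pR y).im = y := fun y => by simp [hpR]
  -- far sides lie in the rectangle and avoid `σ w`
  have sideB_rect : ∀ x ∈ Set.uIcc (0 : ℝ) ε, pB x ∈ axisRect t₀ ε := fun x hx =>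
    ⟨show (pB x).re ∈ Set.uIcc (0 : ℝ) ε by rw [pB_re]; exact hx,
      show (pB x).im ∈ Set.uIcc (t₀ - ε) (t₀ + ε) by rw [pB_im]; exact Set.left_mem_uIcc⟩
  have sideT_rect : ∀ x ∈ Set.uIcc (0 : ℝ) ε, pT x ∈ axisRect t₀ ε := fun x hx =>
    ⟨show (pT x).re ∈ Set.uIcc (0 : ℝ) ε by rw [pT_re]; exact hx,
      show (pT x).im ∈ Set.uIcc (t₀ - ε) (t₀ + ε) by rw [pT_im]; exact Set.right_mem_uIcc⟩
  have sideR_rect : ∀ y ∈ Set.uIcc (t₀ - ε) (t₀ + ε), pR y ∈ axisRect t₀ ε := fun y hy =>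
    ⟨show (pR y).re ∈ Set.uIcc (0 : ℝ) ε by rw [pR_re]; exact Set.right_mem_uIcc,
      show (pR y).im ∈ Set.uIcc (t₀ - ε) (t₀ + ε) by rw [pR_im]; exact hy⟩
  have far_ne : ∀ w ∈ ball w₀ δ, ∀ z ∈ farSides t₀ ε, z ≠ σ w := by
    intro w hw z hz hzσ
    have hc := hC w hw
    rw [← hzσ] at hc
    rcases hz with (⟨x, hx, rfl⟩ | ⟨x, hx, rfl⟩) | ⟨y, hy, rfl⟩
    · have h1 : |(pB x - (t₀ : ℂ) * I).im| ≤ ‖pB x - (t₀ : ℂ) * I‖ := Complex.abs_im_le_norm _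
      have h2 : (pB x - (t₀ : ℂ) * I).im = -ε := by rw [sub_im, pB_im]; simp
      rw [h2, abs_neg, abs_of_pos hε] at h1
      exact absurd (lt_of_le_of_lt h1 hc) (by linarith)
    · have h1 : |(pT x - (t₀ : ℂ) * I).im| ≤ ‖pT x - (t₀ : ℂ) * I‖ := Complex.abs_im_le_norm _
      have h2 : (pT x - (t₀ : ℂ) * I).im = ε := by rw [sub_im, pT_im]; simp
      rw [h2, abs_of_pos hε] at h1
      exact absurd (lt_of_le_of_lt h1 hc) (by linarith)
    · have h1 : |(pR y - (t₀ : ℂ) * I).re| ≤ ‖pR y - (t₀ : ℂ) * I‖ := Complex.abs_re_le_norm _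
      have h2 : (pR y - (t₀ : ℂ) * I).re = ε := by rw [sub_re, pR_re]; simp
      rw [h2, abs_of_pos hε] at h1
      exact absurd (lt_of_le_of_lt h1 hc) (by linarith)
  -- continuity of `z ↦ g w z` along the far sides (parametrised)
  have contB : ∀ w ∈ ball w₀ δ, ContinuousOn (fun x : ℝ => g w (pB x)) (Set.uIcc 0 ε) := fun w hw x hx =>
    ((hA w hw _ (sideB_rect x hx) (far_ne w hw _ (memB x hx))).continuousAt.comp
      (by fun_prop : Continuous pB).continuousAt).continuousWithinAt
  have contT : ∀ w ∈ ball w₀ δ, ContinuousOn (fun x : ℝ => g w (pT x)) (Set.uIcc 0 ε) := fun w hw x hx =>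
    ((hA w hw _ (sideT_rect x hx) (far_ne w hw _ (memT x hx))).continuousAt.comp
      (by fun_prop : Continuous pT).continuousAt).continuousWithinAt
  have contR : ∀ w ∈ ball w₀ δ, ContinuousOn (fun y : ℝ => g w (pR y)) (Set.uIcc (t₀ - ε) (t₀ + ε)) := fun w hw y hy =>
    ((hA w hw _ (sideR_rect y hy) (far_ne w hw _ (memR y hy))).continuousAt.comp
      (by fun_prop : Continuous pR).continuousAt).continuousWithinAt
  -- holomorphy in `w` of the three far-side integrals (dominated holomorphic differentiation)
  have holo_side : ∀ (p : ℝ → ℂ) (a b : ℝ), a ≤ b → (∀ x ∈ Set.uIcc a b, p x ∈ farSides t₀ ε) →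
      (∀ w ∈ ball w₀ δ, ContinuousOn (fun x => g w (p x)) (Set.uIcc a b)) →
      DifferentiableOn ℂ (fun w => ∫ x in a..b, g w (p x)) (ball w₀ δ) := by
    intro p a b hab hp hcont
    have hIoc : Set.Ioc a b ⊆ Set.uIcc a b := by rw [Set.uIcc_of_le hab]; exact Set.Ioc_subset_Icc_self
    have key := differentiableOn_integral_of_dominated_holomorphic isOpen_ball (μ := volume.restrict (Set.Ioc a b))
      (K := fun w x => g w (p x)) (B := fun _ => C)
      (fun w hw => ((hcont w hw).mono hIoc).aestronglyMeasurable measurableSet_Ioc)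
      (by
        filter_upwards [ae_restrict_mem measurableSet_Ioc] with x hx
        intro w hw
        exact ((hD _ (hp x (hIoc hx))) w hw))
      (by
        filter_upwards [ae_restrict_mem measurableSet_Ioc] with x hx w hw
        exact hCb w hw _ (hp x (hIoc hx)))
      (integrableOn_const (hs := measure_Ioc_lt_top.ne))
    refine key.congr fun w hw => ?_
    exact intervalIntegral.integral_of_le hab
  have holoB := holo_side pB 0 ε hε.le memB contB
  have holoT := holo_side pT 0 ε hε.le memT contT
  have holoR := holo_side pR (t₀ - ε) (t₀ + ε) (by linarith) memR contR
  -- the rectangle identity, for each `w`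
  have rect : ∀ w ∈ ball w₀ δ,
      I • (∫ y in (t₀ - ε)..(t₀ + ε), g w ((y : ℂ) * I)) =
        (∫ x in (0 : ℝ)..ε, g w (pB x)) - (∫ x in (0 : ℝ)..ε, g w (pT x)) + I • ∫ y in (t₀ - ε)..(t₀ + ε), g w (pR y) := by
    intro w hw
    obtain ⟨L, hL⟩ := hB w hw
    classical
    set f : ℂ → ℂ := Function.update (g w) (σ w) L with hf
    have hfg : ∀ z, z ≠ σ w → f z = g w z := fun z hz => Function.update_of_ne hz _ _
    -- continuity of `f` on the closed rectangle
    have hcont : ContinuousOn f (axisRect t₀ ε) := by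
      intro z hz
      by_cases hzσ : z = σ w
      · subst hzσ
        exact (continuousAt_update_same.2 hL).continuousWithinAt
      · exact ((continuousAt_update_of_ne hzσ).2 (hA w hw z hz hzσ).continuousAt).continuousWithinAt
    -- differentiability off `{σ w}`
    have hdiff : ∀ z ∈ (Set.Ioo (min (0 : ℝ) ε) (max 0 ε) ×ℂ Set.Ioo (min (t₀ - ε) (t₀ + ε)) (max (t₀ - ε) (t₀ + ε))) \ {σ w},
        DifferentiableAt ℂ f z := by
      rintro z ⟨hz, hzσ⟩
      rw [Set.mem_singleton_iff] at hzσ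
      have hzR : z ∈ axisRect t₀ ε := ⟨Set.Ioo_subset_Icc_self hz.1 |> fun h => by simpa [Set.uIcc] using h,
        Set.Ioo_subset_Icc_self hz.2 |> fun h => by simpa [Set.uIcc] using h⟩
      have hev : f =ᶠ[𝓝 z] g w := by
        filter_upwards [isOpen_ne.mem_nhds hzσ] with u hu using hfg u hu
      exact hev.differentiableAt_iff.2 (hA w hw z hzR hzσ)
    have key := Complex.integral_boundary_rect_eq_zero_of_differentiable_on_off_countable f
      ((t₀ - ε : ℝ) * I) ((ε : ℂ) + (t₀ + ε : ℝ) * I) {σ w} (Set.countable_singleton _)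
    have hre1 : (((t₀ - ε : ℝ) : ℂ) * I).re = 0 := by simp
    have him1 : (((t₀ - ε : ℝ) : ℂ) * I).im = t₀ - ε := by simp
    have hre2 : ((ε : ℂ) + ((t₀ + ε : ℝ) : ℂ) * I).re = ε := by simp
    have him2 : ((ε : ℂ) + ((t₀ + ε : ℝ) : ℂ) * I).im = t₀ + ε := by simp
    simp only [hre1, him1, hre2, him2, ofReal_zero, zero_add] at key
    have key' := key (by simpa [axisRect] using hcont) (by simpa using hdiff)
    -- replace `f` by `g w` on the four sides
    have eB : (∫ x in (0 : ℝ)..ε, f ((x : ℂ) + ((t₀ - ε : ℝ) : ℂ) * I)) = ∫ x in (0 : ℝ)..ε, g w (pB x) :=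
      intervalIntegral.integral_congr fun x hx => hfg _ (far_ne w hw _ (memB x hx))
    have eT : (∫ x in (0 : ℝ)..ε, f ((x : ℂ) + ((t₀ + ε : ℝ) : ℂ) * I)) = ∫ x in (0 : ℝ)..ε, g w (pT x) :=
      intervalIntegral.integral_congr fun x hx => hfg _ (far_ne w hw _ (memT x hx))
    have eR : (∫ y in (t₀ - ε)..(t₀ + ε), f ((ε : ℂ) + (y : ℂ) * I)) = ∫ y in (t₀ - ε)..(t₀ + ε), g w (pR y) :=
      intervalIntegral.integral_congr fun y hy => hfg _ (far_ne w hw _ (memR y hy))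
    have eL : (∫ y in (t₀ - ε)..(t₀ + ε), f ((y : ℂ) * I)) = ∫ y in (t₀ - ε)..(t₀ + ε), g w ((y : ℂ) * I) := by
      refine intervalIntegral.integral_congr_ae ?_
      have hcount : ({y : ℝ | (y : ℂ) * I = σ w} : Set ℝ).Countable := by
        refine Set.Subsingleton.countable fun y₁ h₁ y₂ h₂ => ?_
        have h : (y₁ : ℂ) * I = (y₂ : ℂ) * I := by rw [Set.mem_setOf_eq] at h₁ h₂; rw [h₁, h₂]
        exact_mod_cast mul_right_cancel₀ I_ne_zero h
      have hnull : volume ({y : ℝ | (y : ℂ) * I = σ w} : Set ℝ) = 0 := hcount.measure_zero volume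
      have hae : ∀ᵐ y : ℝ, (y : ℂ) * I ≠ σ w := by
        have := measure_eq_zero_iff_ae_notMem.1 hnull
        filter_upwards [this] with y hy
        simpa using hy
      filter_upwards [hae] with y hy _
      exact hfg _ hy
    rw [eB, eT, eR, eL] at key'
    simp only [smul_eq_mul] at key' ⊢
    linear_combination (-1 : ℂ) * key'
  -- conclusion: the axis-side integral equals a combination of the three holomorphic side integrals
  have hrepr : ∀ w ∈ ball w₀ δ, (∫ y in (t₀ - ε)..(t₀ + ε), g w ((y : ℂ) * I)) =
      -I * ((∫ x in (0 : ℝ)..ε, g w (pB x)) - (∫ x in (0 : ℝ)..ε, g w (pT x)) + I * ∫ y in (t₀ - ε)..(t₀ + ε), g w (pR y)) := by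
    intro w hw
    have h := rect w hw
    simp only [smul_eq_mul] at h
    rw [← h, ← mul_assoc, show -I * I = 1 by rw [neg_mul, I_mul_I, neg_neg], one_mul]
  refine DifferentiableOn.congr (f := fun w => -I * ((∫ x in (0 : ℝ)..ε, g w (pB x)) - (∫ x in (0 : ℝ)..ε, g w (pT x)) +
      I * ∫ y in (t₀ - ε)..(t₀ + ε), g w (pR y))) ?_ hrepr
  exact ((holoB.sub holoT).add (holoR.const_mul I)).const_mul (-I)

end Literature.Analysis.Fourier
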